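import Summits.QuantumFields.BalabanUV.T4Continuum.Support.NE3CovLiftCurl
import Summits.QuantumFields.BalabanUV.T4Continuum.Support.NE3HessForm
import Summits.QuantumFields.BalabanUV.T4Continuum.Support.AveragingDeficitTransport
import Literature.MathematicalPhysics.QuantumFieldTheory.Balaban1983to89.B7Prop1Local
import HarnessLib

/-!
# NE7FirstVariationLocality — THE LOCALITY LETTERS OF THE FIRST VARIATION that the torus road to [Balaban1985Variational] Prop. 8 consumes first (memo §7, brick
# (N2), first half): the first-variation functional `dAction V Y W = −Σ_{p∈W} Re tr[(d_V Y)(p)·V(∂p)]` is ADDITIVE in the window, each plaquette term READS ONLY THE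
# FOUR BONDS of its plaquette (in `V` and in `Y`), and VANISHES at a plaquette where `V` is flat; hence for the cutoff representative `W̃` of the torus road — equal
# to `U^u` on the inner window, flat on the outer window — `dAction W̃ Y = dAction U^u Y (inner) + dAction W̃ Y (shell)` EXACTLY

Cell `pub-balaban`, rung (B)+1 sub-cell t4, lineage `b2b-balaban-t4-ne7-p1` (CRUX PROVER NE7 #1 = OWNER of row NE7), generation 88; memo
`t4/b2b-balaban-t4-ne7-p1-g88/EXISTENCE-BY-INDUCTION.md` §7 (T2)∕(T3).  File F247 (over row NE3's `NE3HessForm` (`dAction`), `NE3CovLiftCurl.curlAt_congr`,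
`AveragingDeficitTransport` (`curl_mem_skewAdjoint`, `nReTr_eq_zero_of_mem_skewAdjoint`), lit-balaban's `B7Prop1Local.hol_plaqWord_eq`).

WHY.  In the torus road (memo §7) the criticality DEFECT `τ` of the cutoff representative `W̃ = e^{χA}` (F245's `hcritD`) is computed window by window: on the inner
window (plaquettes whose bonds carry `χ = 1`) `W̃` coincides with the gauge transform `U^u` of the tangent-critical configuration, so the first variation there is
`U^u`'s (to be PAIRED with transported tangent tests, F244 + `rightInvW`); on the outer window `W̃` is flat, so the first variation there is ZERO; only the shell
carries the commutator sources.  THIS FILE supplies exactly that decomposition, as elementary identities.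
WHAT ([folklore]; 0 def, 0 sorry; any dimension, any group of unitary matrices).
§1 `dAction_union` (disjoint windows), `dAction_sdiff_add` (`W = (W ∖ W₁) ∪ W₁`).
§2 `fhol_congr_of_agree`, `curl_congr_of_agree`, **`dAction_congr_of_agree`** — two configurations and two directions that agree on the four bonds of every plaquette
   of the window have the same `dAction` on it.
§3 `dAction_term_eq_zero_of_flat`, **`dAction_eq_zero_of_flat_on`** — at plaquettes where `V(∂p) = 1` (and `V` unitary, `Y` skew) the first-variation density vanishes.
§4 **`dAction_eq_inner_add_shell`** — the torus-road split: `W = W_in ∪ W_sh ∪ W_out` pairwise disjoint, `W̃` agreeing with `U′` (and `Y` with `Y′`) on the bonds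
   of `W_in`, `W̃` flat on `W_out` ⟹ `dAction W̃ Y W = dAction U′ Y′ W_in + dAction W̃ Y W_sh`.
HONEST FRAMING (page 1): finite-sum bookkeeping; nothing analytic, nothing of Bałaban's asserted; NOT (APE), NOT ONE-STEP, NOT NE7; spine 0∕9; finite T⁴ rung
(B)+1 — NOT infinite volume, NOT mass gap, NOT `BetaPertH`, NOT Clay.  Continuum YM on T⁴ ⇐ BetaPertH ∧ nine spine estimates (0/9 proved); BetaPertH ⇐ (D1) ∧ (D4)
∧ CAP+tail; G-an2-4 gates asym, D1 and NE2/3/4.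
-/

set_option autoImplicit false

open scoped BigOperators Matrix.Norms.L2Operator
open NormedSpace Finset

namespace Summit.QuantumFields.BalabanUV.T4Continuum.NE7FirstVariationLocality

open Literature.MathematicalPhysics.QuantumFieldTheory.Balaban1983to89
open B7Prop1Explicit B7Prop2Explicit UnitaryModel
open B7Prop1Local (hol_plaqWord_eq)
open T4AveragingDeficitWall (IsUnitaryCfg IsSkewDir SmallField curl curlAt fhol)
open AveragingDeficitTransport (curl_mem_skewAdjoint nReTr_eq_zero_of_mem_skewAdjoint)
open NE3HessForm (dAction)
open NE3CovLiftCurl (curlAt_congr)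

noncomputable section

variable {d : ℕ} {n : Type*} [Fintype n] [DecidableEq n]

/-! ## §1 Additivity in the window -/

/-- `dAction` is additive over disjoint windows. [folklore] -/
theorem dAction_union (V : Site d → Fin d → (Matrix n n ℂ)ˣ) (Y : Site d → Fin d → Matrix n n ℂ) {W₁ W₂ : Finset (T4AveragingDeficitWall.Plaq d)}
    (h : Disjoint W₁ W₂) : dAction V Y (W₁ ∪ W₂) = dAction V Y W₁ + dAction V Y W₂ := by
  unfold dAction
  rw [Finset.sum_union h, neg_add]

/-- The window split along a sub-window: `dAction V Y W = dAction V Y (W ∖ W₁) + dAction V Y W₁` for `W₁ ⊆ W`. [folklore] -/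
theorem dAction_sdiff_add (V : Site d → Fin d → (Matrix n n ℂ)ˣ) (Y : Site d → Fin d → Matrix n n ℂ) {W₁ W : Finset (T4AveragingDeficitWall.Plaq d)}
    (h : W₁ ⊆ W) : dAction V Y W = dAction V Y (W \ W₁) + dAction V Y W₁ := by
  rw [← dAction_union V Y Finset.sdiff_disjoint, Finset.sdiff_union_of_subset h]

/-! ## §2 Plaquette locality: each term reads the four bonds of its plaquette -/

/-- The plaquette variable reads the four bonds of the plaquette. [folklore] -/
theorem fhol_congr_of_agree {V V' : Site d → Fin d → (Matrix n n ℂ)ˣ} {z : Site d} {μ ν : Fin d} (h1 : V z μ = V' z μ)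
    (h2 : V (z + e μ) ν = V' (z + e μ) ν) (h3 : V (z + e ν) μ = V' (z + e ν) μ) (h4 : V z ν = V' z ν) :
    hol V z (plaqWord μ ν) = hol V' z (plaqWord μ ν) := by
  rw [hol_plaqWord_eq, hol_plaqWord_eq, h1, h2, h3, h4]

/-- The dressed curl reads the four bonds of the plaquette, in the configuration AND in the direction. [folklore] -/
theorem curlAt_congr_of_agree {V V' : Site d → Fin d → (Matrix n n ℂ)ˣ} {Y Y' : Site d → Fin d → Matrix n n ℂ} {z : Site d} {μ ν : Fin d}
    (h1 : V z μ = V' z μ) (h2 : V (z + e μ) ν = V' (z + e μ) ν) (h3 : V (z + e ν) μ = V' (z + e ν) μ)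
    (k1 : Y z μ = Y' z μ) (k2 : Y (z + e μ) ν = Y' (z + e μ) ν) (k3 : Y (z + e ν) μ = Y' (z + e ν) μ) (k4 : Y z ν = Y' z ν) :
    curlAt V Y z μ ν = curlAt V' Y' z μ ν := by
  rw [curlAt_congr V k1 k2 k3 k4]
  unfold curlAt
  rw [h1, h2, h3]

/-- **PLAQUETTE LOCALITY OF THE FIRST VARIATION**: if `V, V′` agree on the four bonds of every plaquette of the window `W`, and so do `Y, Y′`, then
`dAction V Y W = dAction V′ Y′ W`. [folklore] -/
theorem dAction_congr_of_agree {V V' : Site d → Fin d → (Matrix n n ℂ)ˣ} {Y Y' : Site d → Fin d → Matrix n n ℂ}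
    {W : Finset (T4AveragingDeficitWall.Plaq d)}
    (hV : ∀ p ∈ W, V p.1 p.2.1.1 = V' p.1 p.2.1.1 ∧ V (p.1 + e p.2.1.1) p.2.1.2 = V' (p.1 + e p.2.1.1) p.2.1.2 ∧
      V (p.1 + e p.2.1.2) p.2.1.1 = V' (p.1 + e p.2.1.2) p.2.1.1 ∧ V p.1 p.2.1.2 = V' p.1 p.2.1.2)
    (hY : ∀ p ∈ W, Y p.1 p.2.1.1 = Y' p.1 p.2.1.1 ∧ Y (p.1 + e p.2.1.1) p.2.1.2 = Y' (p.1 + e p.2.1.1) p.2.1.2 ∧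
      Y (p.1 + e p.2.1.2) p.2.1.1 = Y' (p.1 + e p.2.1.2) p.2.1.1 ∧ Y p.1 p.2.1.2 = Y' p.1 p.2.1.2) :
    dAction V Y W = dAction V' Y' W := by
  unfold dAction
  refine congrArg Neg.neg (Finset.sum_congr rfl fun p hp => ?_)
  obtain ⟨h1, h2, h3, h4⟩ := hV p hp
  obtain ⟨k1, k2, k3, k4⟩ := hY p hp
  have hc : curl V Y p = curl V' Y' p := curlAt_congr_of_agree h1 h2 h3 k1 k2 k3 k4
  have hf : fhol V p = fhol V' p := fhol_congr_of_agree h1 h2 h3 h4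
  rw [hc, hf]

/-! ## §3 The first-variation density vanishes at a flat plaquette -/

/-- At a plaquette where `V(∂p) = 1` (`V` unitary, `Y` skew) the first-variation density `−Re tr[(d_V Y)(p)·V(∂p)]` vanishes (`d_V Y(p)` is skew-adjoint,
traceless real part). [folklore] -/
theorem dAction_term_eq_zero_of_flat [Nonempty n] {V : Site d → Fin d → (Matrix n n ℂ)ˣ} (hV : IsUnitaryCfg V) {Y : Site d → Fin d → Matrix n n ℂ}
    (hY : IsSkewDir Y) (p : T4AveragingDeficitWall.Plaq d) (hflat : ((fhol V p : (Matrix n n ℂ)ˣ) : Matrix n n ℂ) = 1) :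
    nReTr (curl V Y p * ((fhol V p : (Matrix n n ℂ)ˣ) : Matrix n n ℂ)) = 0 := by
  rw [hflat, mul_one]
  exact nReTr_eq_zero_of_mem_skewAdjoint (curl_mem_skewAdjoint hV hY p)

/-- **THE FIRST VARIATION VANISHES ON A WINDOW OF FLAT PLAQUETTES**: `V` unitary, `Y` skew, `V(∂p) = 1` for every `p ∈ W` ⟹ `dAction V Y W = 0` (the localised
form of `NE7OneStepOfPathOpen.dAction_eq_zero_of_flat`). [folklore] -/
theorem dAction_eq_zero_of_flat_on [Nonempty n] {V : Site d → Fin d → (Matrix n n ℂ)ˣ} (hV : IsUnitaryCfg V) {Y : Site d → Fin d → Matrix n n ℂ}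
    (hY : IsSkewDir Y) {W : Finset (T4AveragingDeficitWall.Plaq d)} (hflat : ∀ p ∈ W, ((fhol V p : (Matrix n n ℂ)ˣ) : Matrix n n ℂ) = 1) :
    dAction V Y W = 0 := by
  unfold dAction
  rw [neg_eq_zero]
  exact Finset.sum_eq_zero fun p hp => dAction_term_eq_zero_of_flat hV hY p (hflat p hp)

/-- A sufficient condition for `V(∂p) = 1` in the norm form the classes use: `‖V(∂p) − 1‖ ≤ 0`. [folklore] -/
theorem fhol_eq_one_of_norm_le_zero {V : Site d → Fin d → (Matrix n n ℂ)ˣ} (p : T4AveragingDeficitWall.Plaq d)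
    (h : ‖((fhol V p : (Matrix n n ℂ)ˣ) : Matrix n n ℂ) - 1‖ ≤ 0) : ((fhol V p : (Matrix n n ℂ)ˣ) : Matrix n n ℂ) = 1 :=
  sub_eq_zero.mp (norm_le_zero_iff.mp h)

/-! ## §4 The torus-road split of the first variation of the cutoff representative -/

/-- **`dAction W̃ Y W = dAction U′ Y′ W_in + dAction W̃ Y W_sh`** for a window `W = W_in ∪ W_sh ∪ W_out` (pairwise disjoint), a unitary `W̃` agreeing with `U′` on the
bonds of the plaquettes of `W_in` (where also `Y = Y′`), and FLAT on the plaquettes of `W_out`; `Y` skew.  In the torus road: `W̃ = e^{χA}`, `U′ = U^u`, `Y′` the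
test field read inside, `W_in` = plaquettes with `χ = 1` on their bonds, `W_out` = plaquettes outside the cube. [folklore] -/
theorem dAction_eq_inner_add_shell [Nonempty n] {Wt U' : Site d → Fin d → (Matrix n n ℂ)ˣ} (hWt : IsUnitaryCfg Wt) {Y Y' : Site d → Fin d → Matrix n n ℂ}
    (hY : IsSkewDir Y) {Win Wsh Wout : Finset (T4AveragingDeficitWall.Plaq d)} (h1 : Disjoint Win Wsh) (h2 : Disjoint (Win ∪ Wsh) Wout)
    (hin : ∀ p ∈ Win, Wt p.1 p.2.1.1 = U' p.1 p.2.1.1 ∧ Wt (p.1 + e p.2.1.1) p.2.1.2 = U' (p.1 + e p.2.1.1) p.2.1.2 ∧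
      Wt (p.1 + e p.2.1.2) p.2.1.1 = U' (p.1 + e p.2.1.2) p.2.1.1 ∧ Wt p.1 p.2.1.2 = U' p.1 p.2.1.2)
    (hYin : ∀ p ∈ Win, Y p.1 p.2.1.1 = Y' p.1 p.2.1.1 ∧ Y (p.1 + e p.2.1.1) p.2.1.2 = Y' (p.1 + e p.2.1.1) p.2.1.2 ∧
      Y (p.1 + e p.2.1.2) p.2.1.1 = Y' (p.1 + e p.2.1.2) p.2.1.1 ∧ Y p.1 p.2.1.2 = Y' p.1 p.2.1.2)
    (hout : ∀ p ∈ Wout, ((fhol Wt p : (Matrix n n ℂ)ˣ) : Matrix n n ℂ) = 1) :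
    dAction Wt Y (Win ∪ Wsh ∪ Wout) = dAction U' Y' Win + dAction Wt Y Wsh := by
  rw [dAction_union Wt Y h2, dAction_union Wt Y h1, dAction_eq_zero_of_flat_on hWt hY hout, add_zero, dAction_congr_of_agree hin hYin]

end

end Summit.QuantumFields.BalabanUV.T4Continuum.NE7FirstVariationLocality
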